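import Mathlib.MeasureTheory.Group.Integral
import Mathlib.Analysis.Calculus.MeanValue
import Summits.AtomisticToContinuum.HydrodynamicLimit.Theorems.CollisionIsometryCLTMesoscopicLLNKernels
import Summits.AtomisticToContinuum.HydrodynamicLimit.Theorems.CollisionIsometryCLTMacroClosureDefs

/-!
# Stub `stub_balance_B4` of the line `IdeatorTwoGen1Sketch` (crux `MacroClosure`, stmt-14870):
# the mollifier commutator

Conjunct (B4) of `BalanceIdentity`: replacing a smooth weight `w(xᵢ)` by its block average
`∫ₓ w(x) φ(xᵢ − x) dx` costs at most `r · ‖∇w‖∞` per particle when `φ ≥ 0` is integrable, has unit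
mass and is supported in the minimal-image ball `{euclidDist(·, 0) < r}`:
`|⟨emp z, w g⟩ − ∫ₓ w(x) ⟨emp z, φ(· − x) g⟩ dx| ≤ r L ⟨emp z, |g|⟩`.

Proof. Every integral against `empiricalMeasure z` is a finite average (`integral_empiricalMeasure`),
so the `x`-integral of the block functional is `(N+1)⁻¹ Σᵢ g(vᵢ) ∫ₓ w(x) φ(xᵢ − x) dx`
(`integral_finsetSum`; the summands
`x ↦ w x · φ(xᵢ − x)` are integrable: `w` is continuous hence bounded on the compact torus and
`φ(xᵢ − ·)` is integrable by translation and negation invariance of the Haar probability measure of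
`T³`, reused from `…Theorems.CollisionIsometryCLTMesoscopicLLNKernels`: `MesoLLN.isNegInvariant_volume_T3`,
`MesoLLN.integral_comp_sub_left`). By the same invariance `∫ₓ φ(xᵢ − x) dx = ∫ φ = 1`, whence
`w(xᵢ) − ∫ₓ w(x) φ(xᵢ − x) dx = ∫ₓ (w(xᵢ) − w(x)) φ(xᵢ − x) dx`; on the support of `φ(xᵢ − ·)` the
minimal-image distance of `xᵢ` and `x` is `< r`, and the mean value inequality on `ℝ³` along the
minimal-image segment (`Convex.norm_image_sub_le_of_norm_fderiv_le` for the periodic lift, whose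
derivative has the norm of the torus gradient) gives `|w(xᵢ) − w(x)| ≤ L · euclidDist xᵢ x ≤ r L`.
Summing with the weights `|g(vᵢ)|/(N+1)` gives the claim.
-/

noncomputable section

open MeasureTheory Filter Set Topology InformationTheory
open scoped ENNReal ContDiff

namespace Summit.AtomisticToContinuum.HydrodynamicLimit.Theorems.MacroClosureLine

open Literature.MathematicalPhysics.KineticTheory Literature.Analysis.FluidPDE
open Literature.Analysis.FunctionSpaces

namespace Barycentric

namespace B4

/-! ## Haar calculus on `T³` (negation invariance and `∫ φ(y - x) dx = ∫ φ` are the landed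
`MesoLLN.isNegInvariant_volume_T3`, `MesoLLN.integral_comp_sub_left`) -/

/-- The reflected translate `x ↦ φ(y - x)` of an integrable `φ` is integrable (translation and
negation invariance of the Haar probability measure of `T³`). -/
theorem integrable_comp_sub_left {φ : T3 → ℝ} (hφ : Integrable φ) (y : T3) :
    Integrable (fun x => φ (y - x)) := by
  haveI := MesoLLN.isNegInvariant_volume_T3
  exact hφ.comp_sub_left y

/-- A continuous weight times the reflected translate of an integrable kernel is integrable. -/
theorem integrable_mul_comp_sub_left {w : T3 → ℝ} (hw : Continuous w) {φ : T3 → ℝ}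
    (hφ : Integrable φ) (y : T3) : Integrable (fun x => w x * φ (y - x)) := by
  obtain ⟨C, hC⟩ := hw.bounded_above_of_compact_support (HasCompactSupport.of_compactSpace w)
  exact (integrable_comp_sub_left hφ y).bdd_mul hw.aestronglyMeasurable (ae_of_all _ hC)

/-! ## Mean value inequality on `T³` in the minimal-image distance -/

/-- The torus gradient and the torus Fréchet derivative have the same norm. -/
theorem norm_gradient_eq_norm_fderiv (w : T3 → ℝ) (x : T3) :
    ‖Torus.gradient w x‖ = ‖Torus.fderiv w x‖ := by
  rw [Torus.gradient, _root_.gradient]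
  exact (InnerProductSpace.toDual ℝ V3).symm.norm_map _

/-- **Mean value inequality on the torus.** A smooth `w : T³ → ℝ` with `‖∇w‖ ≤ L` everywhere is
`L`-Lipschitz for the minimal-image distance: `|w x - w y| ≤ L · euclidDist x y` (mean value
inequality on `ℝ³` between a lift `y'` of `y` and `y' + reprSym (x - y)`, which lifts `x`). -/
theorem abs_sub_le_mul_euclidDist {w : T3 → ℝ} (hw : Torus.IsSmooth w) {L : ℝ}
    (hL : ∀ x, ‖Torus.gradient w x‖ ≤ L) (x y : T3) :
    |w x - w y| ≤ L * Torus.euclidDist x y := by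
  have hC1 : ContDiff ℝ 1 (Torus.lift w) := hw.isContDiff (by simp)
  have hd : Differentiable ℝ (Torus.lift w) := hC1.differentiable one_ne_zero
  obtain ⟨y', hy'⟩ := Torus.proj_surjective y
  have hx : Torus.proj (y' + Torus.reprSym (x - y)) = x := by
    rw [Torus.proj_add, hy', Torus.proj_reprSym, add_sub_cancel]
  have hmv := Convex.norm_image_sub_le_of_norm_fderiv_le (f := Torus.lift w) (s := Set.univ)
    (x := y') (y := y' + Torus.reprSym (x - y)) (C := L) (fun v _ => hd v) (fun v _ => ?_)
    convex_univ (mem_univ _) (mem_univ _)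
  · rw [Torus.lift_apply, Torus.lift_apply, hx, hy', add_sub_cancel_left, Real.norm_eq_abs] at hmv
    rw [Torus.euclidDist_eq]
    exact hmv
  · rw [Torus.fderiv_lift, ← norm_gradient_eq_norm_fderiv]
    exact hL _

/-! ## The one-particle commutator -/

/-- **One-particle mollifier commutator.** For an integrable kernel `φ ≥ 0` of unit mass supported
in `{euclidDist(·, 0) < r}` and a smooth weight with `‖∇w‖ ≤ L`:
`|w p - ∫ₓ w(x) φ(p - x) dx| ≤ r L`. -/
theorem abs_sub_integral_mul_translate_le {φ : T3 → ℝ} {r L : ℝ} (hφ0 : ∀ y, 0 ≤ φ y)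
    (hφi : Integrable φ) (hφ1 : ∫ y, φ y = 1) (hsupp : ∀ y, r ≤ Torus.euclidDist y 0 → φ y = 0)
    {w : T3 → ℝ} (hw : Torus.IsSmooth w) (hL : ∀ x, ‖Torus.gradient w x‖ ≤ L) (p : T3) :
    |w p - ∫ x, w x * φ (p - x)| ≤ r * L := by
  have hL0 : 0 ≤ L := (norm_nonneg _).trans (hL p)
  have h1 : ∫ x, φ (p - x) = 1 := by rw [MesoLLN.integral_comp_sub_left φ p, hφ1]
  have hint : Integrable (fun x => φ (p - x)) := integrable_comp_sub_left hφi p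
  have hint2 : Integrable (fun x => w x * φ (p - x)) :=
    integrable_mul_comp_sub_left hw.continuous hφi p
  have hint3 : Integrable (fun x => (w p - w x) * φ (p - x)) :=
    integrable_mul_comp_sub_left (continuous_const.sub hw.continuous) hφi p
  have hpt : ∀ x, |w p - w x| * φ (p - x) ≤ r * L * φ (p - x) := by
    intro x
    by_cases hx : φ (p - x) = 0
    · rw [hx, mul_zero, mul_zero]
    · have hlt : Torus.euclidDist p x < r := by
        rw [← MesoLLN.euclidDist_sub_zero]
        by_contra h
        exact hx (hsupp _ (le_of_not_gt h))
      refine mul_le_mul_of_nonneg_right ?_ (hφ0 _)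
      calc |w p - w x| ≤ L * Torus.euclidDist p x := abs_sub_le_mul_euclidDist hw hL p x
        _ ≤ L * r := mul_le_mul_of_nonneg_left hlt.le hL0
        _ = r * L := mul_comm _ _
  have hrepr : w p - ∫ x, w x * φ (p - x) = ∫ x, (w p - w x) * φ (p - x) := by
    simp_rw [sub_mul]
    rw [integral_sub (hint.const_mul _) hint2, integral_const_mul, h1, mul_one]
  rw [hrepr]
  calc |∫ x, (w p - w x) * φ (p - x)| ≤ ∫ x, |(w p - w x) * φ (p - x)| :=
        abs_integral_le_integral_abs
    _ ≤ ∫ x, r * L * φ (p - x) := by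
        refine integral_mono hint3.abs (hint.const_mul _) fun x => ?_
        dsimp only
        rw [abs_mul, abs_of_nonneg (hφ0 _)]
        exact hpt x
    _ = r * L := by rw [integral_const_mul, h1, mul_one]

end B4

/-! ## The stub -/

/-- **(B4) of `BalanceIdentity`: the mollifier commutator.** For an integrable kernel `φ ≥ 0` of
unit mass supported in the minimal-image ball `{euclidDist(·, 0) < r}`, a smooth weight `w` with
`‖∇w‖ ≤ L`, any velocity weight `g` and any configuration `z` of `N + 1` spheres,
`|⟨emp z, w g⟩ − ∫ₓ w(x) ⟨emp z, φ(· − x) g⟩ dx| ≤ r L ⟨emp z, |g|⟩`. -/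
theorem stub_balance_B4 : ∀ (N : ℕ) (φ : T3 → ℝ) (r L : ℝ), (∀ y, 0 ≤ φ y) → Integrable φ → ∫ y, φ y = 1 → (∀ y, r ≤ Torus.euclidDist y 0 → φ y = 0) → ∀ w : T3 → ℝ, Torus.IsSmooth w → (∀ x, ‖Torus.gradient w x‖ ≤ L) → ∀ (g : V3 → ℝ) (z : Config (N + 1) (Fin 3) T3), |(∫ y, w y.1 * g y.2 ∂(empiricalMeasure z)) - ∫ x, w x * ∫ y, φ (y.1 - x) * g y.2 ∂(empiricalMeasure z)| ≤ r * L * ∫ y, |g y.2| ∂(empiricalMeasure z) := by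
  intro N φ r L hφ0 hφi hφ1 hsupp w hw hL g z
  have key : ∀ i : Fin (N + 1), |w (z i).1 - ∫ x, w x * φ ((z i).1 - x)| ≤ r * L := fun i =>
    B4.abs_sub_integral_mul_translate_le hφ0 hφi hφ1 hsupp hw hL (z i).1
  have hint2 : ∀ i : Fin (N + 1), Integrable (fun x => w x * φ ((z i).1 - x)) := fun i =>
    B4.integrable_mul_comp_sub_left hw.continuous hφi (z i).1
  have hc0 : (0 : ℝ) ≤ ((N + 1 : ℕ) : ℝ)⁻¹ := inv_nonneg.2 (Nat.cast_nonneg _)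
  have hA : ∫ y, w y.1 * g y.2 ∂(empiricalMeasure z) =
      ((N + 1 : ℕ) : ℝ)⁻¹ * ∑ i, w (z i).1 * g (z i).2 :=
    integral_empiricalMeasure z _
  have hI : ∀ x, ∫ y, φ (y.1 - x) * g y.2 ∂(empiricalMeasure z) =
      ((N + 1 : ℕ) : ℝ)⁻¹ * ∑ i, φ ((z i).1 - x) * g (z i).2 := fun x =>
    integral_empiricalMeasure z _
  have hG : ∫ y, |g y.2| ∂(empiricalMeasure z) = ((N + 1 : ℕ) : ℝ)⁻¹ * ∑ i, |g (z i).2| :=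
    integral_empiricalMeasure z _
  have hB : ∫ x, w x * ∫ y, φ (y.1 - x) * g y.2 ∂(empiricalMeasure z) =
      ((N + 1 : ℕ) : ℝ)⁻¹ * ∑ i, g (z i).2 * ∫ x, w x * φ ((z i).1 - x) := by
    simp_rw [hI]
    have hx : ∀ x, w x * (((N + 1 : ℕ) : ℝ)⁻¹ * ∑ i, φ ((z i).1 - x) * g (z i).2) =
        ∑ i, (((N + 1 : ℕ) : ℝ)⁻¹ * g (z i).2) * (w x * φ ((z i).1 - x)) := by
      intro x
      rw [Finset.mul_sum, Finset.mul_sum]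
      exact Finset.sum_congr rfl fun i _ => by ring
    simp_rw [hx]
    rw [integral_finsetSum _ fun i _ => (hint2 i).const_mul _, Finset.mul_sum]
    refine Finset.sum_congr rfl fun i _ => ?_
    rw [integral_const_mul, mul_assoc]
  rw [hA, hB, hG, ← mul_sub, ← Finset.sum_sub_distrib, abs_mul, abs_of_nonneg hc0]
  calc ((N + 1 : ℕ) : ℝ)⁻¹ * |∑ i, (w (z i).1 * g (z i).2 - g (z i).2 * ∫ x, w x * φ ((z i).1 - x))|
      ≤ ((N + 1 : ℕ) : ℝ)⁻¹ * (r * L * ∑ i, |g (z i).2|) := by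
        refine mul_le_mul_of_nonneg_left ?_ hc0
        calc |∑ i, (w (z i).1 * g (z i).2 - g (z i).2 * ∫ x, w x * φ ((z i).1 - x))|
            ≤ ∑ i, |w (z i).1 * g (z i).2 - g (z i).2 * ∫ x, w x * φ ((z i).1 - x)| :=
              Finset.abs_sum_le_sum_abs _ _
          _ = ∑ i, |g (z i).2| * |w (z i).1 - ∫ x, w x * φ ((z i).1 - x)| := by
              refine Finset.sum_congr rfl fun i _ => ?_
              rw [← abs_mul]
              congr 1
              ring
          _ ≤ ∑ i, |g (z i).2| * (r * L) :=
              Finset.sum_le_sum fun i _ => mul_le_mul_of_nonneg_left (key i) (abs_nonneg _)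
          _ = r * L * ∑ i, |g (z i).2| := by rw [← Finset.sum_mul, mul_comm]
    _ = r * L * (((N + 1 : ℕ) : ℝ)⁻¹ * ∑ i, |g (z i).2|) := by ring

end Barycentric

end Summit.AtomisticToContinuum.HydrodynamicLimit.Theorems.MacroClosureLine

end
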